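import Literature.NumberTheory.Automorphic.Liu2021.Def411WeilCarriersIrreducibleOfLemD1
import Literature.NumberTheory.Automorphic.Liu2021.LemD1DataOfPlace
import Literature.NumberTheory.Automorphic.Liu2021.Def411WeilCarriersChiUnitary
import Literature.NumberTheory.Automorphic.UnitaryGroupPlaceInclusion
import HarnessLib

/-!
# [Liu2021, Def. 4.11]'s «irreducible» for `ω(μ, ε, χ)` from Lemma D.1 (1) AS PRINTED, place by place, with the twist exposed

Topic `NumberTheory/Automorphic/Liu2021`.  KERNEL ONLY: one definition with body (`localLemD1Data`, the as-printed
datum of [Liu2021, App. D §D.1] at a finite place for the pair `(V, ⟨a⟩)`) and theorems; no record, no named fact,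
no `sorry`.  Nothing of [Liu2021] is asserted: Lemma D.1 (1) enters only as the HYPOTHESIS `LemD1_1AsPrinted (…)` of
`Liu2021/LemD1AsPrinted.lean`, one instance per finite place.  HC_CM is not mentioned by this file.

## What this file adds to the chain `… → Def411WeilCarriersIrreducibleOfLocal` (F5) `→ Def411WeilCarriersIrreducibleOfLemD1` (F6)

F6's `Def411WeilCarriers.rho_isIrreducible_of_lemD1_local` delivers the END displays' `hirr` —
`(rho … ι ε χ).IsIrreducible` — from a local input demanded at the local components `χ_{1,v}` of EVERY continuous
character `χ₁` of the centre `E¹(𝔸_{F,f})`.  That universal quantifier is forced by F5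
(`rho_isIrreducible_of_omega_center`): the twist `χtw` between the displayed splitting `s_{lineOf ε}` and the local
reference section of `𝓢` is only known to EXIST and to be continuous (`exists_twist_localRefSection_continuous`), with
values in the scalars `ℂˣ` of `Mp_ψ(𝕎_𝔸)ᶜᵒⁿᵗ`; so the character of the centre that actually matters,
`u ↦ χtw(1, u·1_W)⁻¹ · χ(u)`, is some unnamed continuous character, and F5/F6 quantify over all of them.

[Liu2021, App. D Lemma D.1] AS PRINTED, however, is typed for a UNITARY character `χ : E¹ → ℂ¹`
(`LemD1Data.norm_chi`; the junction `LemD1OfPlace.data` of `Liu2021/LemD1DataOfPlace.lean` asks `‖χ h‖ = 1`), and a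
continuous character of `E_v¹` need not be unitary (at a split place `E_v¹ ≅ F_vˣ` carries `|·|^s`).  So Lemma D.1 (1)
as printed CANNOT discharge F6's hypothesis (i) over its full quantifier — only over the unitary sub-family.

The fix typed here is to EXPOSE THE TWIST: every theorem below takes the twist `χtw` (with its defining equation
`pairSmall₁ s ∘ finPairToAdelic = localRefSection 𝓢 ⊗ χtw`, the shape of F5's `hχ`) and a factorisation
`χ_W = χtw(1, ·) · χ''` of the line character as HYPOTHESES, and asks the local input at the local components of the
ONE character `χ₁ = χ'' ∘ (u ↦ u·1_W)` of the centre.  When the displayed splitting family FACTORS through the local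
reference section of `𝓢` (`χtw = 1`, hypothesis `hfac` of `rho_isIrreducible_of_lemD1AsPrinted_of_factors`), that
character is `χ` itself, which IS unitary once `‖χ‖ = 1` is known (automorphic characters of the compact quotient
`E¹\E¹(𝔸_{F,f})` are unitary — the hypothesis `hχn` of `…_of_factors`; for `χ ∈ Chi F E c` it is the THEOREM
`Def411WeilCarriers.norm_chi_eq_one` of `Liu2021/Def411WeilCarriersChiUnitary` (compactness of `E¹\U(1)(𝔸_F)`), consumed
by the binder-free form `rho_isIrreducible_of_lemD1AsPrinted`, §5).

* `UnitaryGroup.localCharOfCenter_eq_comp_inclPlace`, `continuous_localCharOfCenter`, `continuous_coe_localCharOfCenter`,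
  `norm_localCharOfCenter` — `χ_{1,v} = χ₁ ∘ (u·1_1 ↦ u) ∘ inclPlace v`; the local components `χ_{1,v}` of a continuous
  (resp. unitary) character of `E¹(𝔸_{F,f})` are continuous (resp. unitary);
* `Def411WeilCarriers.reindex_kronecker_JW_hermitian`, `det_reindex_kronecker_JW_ne_zero` — the big form
  `J_V ⊗ (a) = reindex e e (J_V ⊗ₖ J_W)` is hermitian with non-zero determinant (inputs of `LemD1OfPlace.standingData`);
* `Def411WeilCarriers.localLemD1Data … a 𝓢 hn μ … χ₁ … v` — [Liu2021, App. D §D.1]'s data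
  `(F_v, E_v, U(V_v), ε_v, μ_v, χ_{1,v}; ω_v)` AS PRINTED (`LemD1Data`) at the place `v` for `V ⊗ ⟨a⟩`: the junction
  `LemD1OfPlace.data` on the carrier `ω_v = 𝓢.omegaLoc v` (Liu's `ω(ε_v) ∘ ι_{μ_v}` read on `𝒮(F_vⁿ)`), Step 2's `μ_v`
  the caller's, Step 3's character the local component `χ_{1,v}`;
* `Def411WeilCarriers.rho_isIrreducible_of_omega_center_of_twist` — F5 with the twist GIVEN: `hirr` ⟸ the
  `U(J_V)(𝔸_f)`-action on the maximal quotient of `Ω = ⊗'_v ω_v` where the centre acts by the single character `χ₁` is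
  irreducible;
* `Def411WeilCarriers.rho_isIrreducible_of_lemD1_local_of_twist` — F6's `TwistedCoinv` currency at the single
  character `χ₁` («irreducible admissible» local central quotients + survival of `1_{𝒪_vⁿ}` off a finite set);
* **`Def411WeilCarriers.rho_isIrreducible_of_lemD1AsPrinted_of_twist`** — `hirr` ⟸ { the twist data; `χ₁` continuous
  and unitary; per-place `μ_v` with Step 2's three printed properties; **[Liu2021, Lemma D.1 (1)] AS PRINTED for the
  datum `localLemD1Data … v` at every finite `v`**; Def. 4.11's `⊗'` clause (the class of `1_{𝒪_vⁿ}` survives off a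
  finite set); `n ≥ 3` };
* **`Def411WeilCarriers.rho_isIrreducible_of_lemD1AsPrinted_of_factors`** — the same when `s_{lineOf ε}` factors
  through the local reference section of `𝓢` (`χtw = 1`): the character is `χ` itself;
* **`Def411WeilCarriers.rho_isIrreducible_of_lemD1AsPrinted`** (§5) — `…_of_factors` with NO unitarity binder: `‖χ u‖ = 1`
  is `norm_chi_eq_one` (`[E : F] = 2` from the standing `[Algebra.IsQuadraticExtension F E]`, `c ≠ 1` from `c δ = -δ`,
  `δ ≠ 0` — `UnitaryGroup.algEquiv_ne_one_of_apply_eq_neg`).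

Caveat for END displays (registered with the cell): do NOT transplant F6's «for every continuous `χ₁`» hypothesis
shape into an END display — with Lemma D.1 typed as printed it is dischargeable only on unitary `χ₁`; display either
the abstract `hirr` or a single-character form.  The sister typing `Liu2021/Def411WeilCarriersIrreducibleAtTwist`
(item (vi) lane) keeps the twist INTERNAL instead — its local input is asked at the character
`u ↦ χtw(1, u·1_W)⁻¹ · χ(u)` for every continuous twist `χtw` of `s_{lineOf ε}` against the local reference section, in
the `TwistedCoinv` and Lem.-D.1-RECORD currencies; the present file takes the twist as a hypothesis (or `= 1`) and goes
through the AS-PRINTED predicate; the two meet at the unitarity `‖χ₁‖ = 1` of that one character.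

## References
* [Liu2021] Y. Liu, Camb. J. Math. 9 (2021) = arXiv:2102.11518: Def. 4.11 (l. 2083–2097), App. D §D.1 Steps 1∕2∕3
  (l. 5217∕5219∕5221), Lemma D.1 (l. 5227; (1) l. 5229) — `l. NNNN` = lines of the arXiv source `FJcycle.tex`; chunk p0056
  L8–L23 of the held extraction `paper:arxiv-2102.11518` (App. D §D.1 = arXiv PDF p. 76).
* [GelbartRogawski1991] S. Gelbart, J. Rogawski, Invent. Math. 105 (1991), §3.1 p. 454, Prop. 3.1.1 p. 455 L1–3,
  Remark p. 457 L4–13.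
* [TateThesis1967] J. Tate, in Cassels–Fröhlich (1967), §3.2 Lemma 3.2.1 (characters of restricted products).
* [Flath1979] D. Flath, PSPM 33 (1979) part 1, Thm. 2, Ex. 2.
* [MoeglinVignerasWaldspurger1987] C. Mœglin, M.-F. Vignéras, J.-L. Waldspurger, LNM 1291, Chap. 2 II.1 (B).
* [Godement1964] R. Godement, *Domaines fondamentaux des groupes arithmétiques*, Sém. Bourbaki 257 (1962/63), §5 Thm. 4
  (compactness criterion; here `E¹ \ U(1)(𝔸_F)` compact — the input of `norm_chi_eq_one`, §5).
-/

set_option autoImplicit false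

noncomputable section

open scoped Matrix Kronecker TensorProduct Classical RestrictedProduct
open NumberField NumberField.mixedEmbedding IsDedekindDomain Filter Set
open Literature.NumberTheory.Automorphic Literature.NumberTheory.Automorphic.UnitaryGroup
open Literature.NumberTheory.Weil1964 Literature.RepresentationTheory
open Literature.RepresentationTheory.HeisenbergGroup
open Literature.GroupTheory.RestrictedProductCharacter

/-! ## §1 Local components of a continuous / unitary character of the centre -/

namespace Literature.NumberTheory.Automorphic.UnitaryGroup

variable (F E : Type) [Field F] [NumberField F] [Field E] [NumberField E] [Algebra F E]
variable (c : E ≃ₐ[F] E) (J₁ : Matrix (Fin 1) (Fin 1) E)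

/-- `χ_{1,v} = χ₁ ∘ (u·1_1 ↦ u) ∘ inclPlace v`: the local component is `χ₁` read through the place inclusion
`U(J₁)(F_v) →* U(J₁)(𝔸_{F,f})` of `UnitaryGroupPlaceInclusion` (definitionally). [cite: TateThesis1967, §3.2 Lemma 3.2.1] -/
theorem localCharOfCenter_eq_comp_inclPlace (hJ₁ : J₁ 0 0 ≠ 0) (χ₁ : finAdelicOne F E c →* ℂˣ)
    (v : HeightOneSpectrum (𝓞 F)) :
    localCharOfCenter F E c J₁ hJ₁ χ₁ v = (χ₁.comp (finAdelicCenterInv F E c J₁ hJ₁)).comp (inclPlace F E c 1 J₁ v) :=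
  MonoidHom.ext fun _ => rfl

/-- **`χ_{1,v}` is continuous for `χ₁` continuous** (`inclPlace v` and `finAdelicCenterInv` are).
[cite: TateThesis1967, §3.2 Lemma 3.2.1] -/
theorem continuous_localCharOfCenter (hJ₁ : J₁ 0 0 ≠ 0) {χ₁ : finAdelicOne F E c →* ℂˣ} (hχ₁ : Continuous χ₁)
    (v : HeightOneSpectrum (𝓞 F)) : Continuous (localCharOfCenter F E c J₁ hJ₁ χ₁ v) := by
  rw [localCharOfCenter_eq_comp_inclPlace]
  exact hχ₁.comp ((continuous_finAdelicCenterInv F E c J₁ hJ₁).comp (continuous_inclPlace F E c 1 J₁ v))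

/-- `x ↦ (χ_{1,v} x : ℂ)` is continuous for `χ₁` continuous (the `ℂ`-valued form asked by `LemD1Data.continuous_chi`).
[cite: TateThesis1967, §3.2 Lemma 3.2.1] -/
theorem continuous_coe_localCharOfCenter (hJ₁ : J₁ 0 0 ≠ 0) {χ₁ : finAdelicOne F E c →* ℂˣ} (hχ₁ : Continuous χ₁)
    (v : HeightOneSpectrum (𝓞 F)) : Continuous fun x => ((localCharOfCenter F E c J₁ hJ₁ χ₁ v x : ℂˣ) : ℂ) :=
  Units.continuous_val.comp (continuous_localCharOfCenter F E c J₁ hJ₁ hχ₁ v)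

/-- **`χ_{1,v}` is unitary for `χ₁` unitary**: `‖χ_{1,v} x‖ = 1` (`χ_{1,v} x` is a value of `χ₁`).
[cite: TateThesis1967, §3.2 Lemma 3.2.1] -/
theorem norm_localCharOfCenter (hJ₁ : J₁ 0 0 ≠ 0) {χ₁ : finAdelicOne F E c →* ℂˣ}
    (hχ₁ : ∀ u, ‖((χ₁ u : ℂˣ) : ℂ)‖ = 1) (v : HeightOneSpectrum (𝓞 F)) (x : localPi E c 1 J₁ v) :
    ‖((localCharOfCenter F E c J₁ hJ₁ χ₁ v x : ℂˣ) : ℂ)‖ = 1 :=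
  hχ₁ _

omit [NumberField F] in
/-- **`c ≠ 1` from the standing data**: an automorphism `c` with `c δ = -δ` for some `δ ≠ 0` (the `δ ∈ E^{×,−}` of
[Liu2021, App. D §D.1]'s standing data, l. 5213) is not the identity — in characteristic `0`, `δ = -δ` forces `δ = 0`.
(Supplies the `c ≠ 1` of `Def411WeilCarriers.norm_chi_eq_one`.) [cite: Liu2021, App. D §D.1 (l. 5213), arXiv:2102.11518 chunk p0056 L8 (arXiv PDF p. 76)] -/
theorem algEquiv_ne_one_of_apply_eq_neg {δ : E} (hcδ : c δ = -δ) (hδ : δ ≠ 0) : c ≠ 1 := by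
  rintro rfl
  rw [AlgEquiv.one_apply] at hcδ
  have h2 : (2 : E) * δ = 0 := by linear_combination hcδ
  exact hδ ((mul_eq_zero.mp h2).resolve_left two_ne_zero)

end Literature.NumberTheory.Automorphic.UnitaryGroup

/-! ## §2 The as-printed datum of App. D §D.1 at a place, for the pair `(V, ⟨a⟩)`; `hirr` from Lemma D.1 (1) as printed -/

section Liu

open Literature.NumberTheory Literature.NumberTheory.Automorphic
open Literature.NumberTheory.GelbartRogawski1991 Literature.NumberTheory.GelbartRogawski1991.UnitaryDualPair
open Literature.NumberTheory.GelbartRogawski1991.UnitaryDualPair.WeilCoinv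

namespace Literature.NumberTheory.Automorphic.Liu2021.Def411WeilCarriers

variable (F E : Type) [Field F] [NumberField F] [Field E] [NumberField E] [Algebra F E]
variable (c : E ≃ₐ[F] E) (N : ℕ) {n : ℕ} (e : Fin N × Fin 1 ≃ Fin n)
variable (JV : Matrix (Fin N) (Fin N) E) {TV : Matrix (Fin N) (Fin N) F}
variable [Algebra.IsQuadraticExtension F E] {δ : E} (hcδ : c δ = -δ) (hδ : δ ≠ 0) {d : F}
  (hd : δ * δ = algebraMap F E d) (hV : TV.IsSymm) (hVd : IsUnit TV.det) (hJV : JV = TV.map (algebraMap F E))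

/-! ### the big hermitian form `J_V ⊗ (a)` of the pair `(V, ⟨a⟩)` -/

section BigForm

omit [NumberField F] [NumberField E] [Algebra.IsQuadraticExtension F E] in
include hV hJV in
/-- `J_V ⊗ (a) = reindex e e (J_V ⊗ₖ J_W)` is hermitian: `((J_V ⊗ (a))ᶜ)ᵀ = J_V ⊗ (a)` (it is `gram F e T_V (a) ⊗ 1` with
`gram` symmetric over `F`). [cite: GelbartRogawski1991, §3.1 p. 454] -/
theorem reindex_kronecker_JW_hermitian (a : Fˣ) :
    ((Matrix.reindex e e (JV ⊗ₖ JW F E a)).map c)ᵀ = Matrix.reindex e e (JV ⊗ₖ JW F E a) := by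
  rw [reindex_kronecker_eq_gram_map F E e hJV (JW_eq F E a), Matrix.map_map]
  have h : (⇑c ∘ ⇑(algebraMap F E)) = ⇑(algebraMap F E) := funext fun t => c.commutes t
  rw [h, ← Matrix.transpose_map, (isSymm_gram F e hV (isSymm_TW F a)).eq]

omit [NumberField F] [NumberField E] [Algebra.IsQuadraticExtension F E] in
include hVd hJV in
/-- `det (J_V ⊗ (a)) ≠ 0` (`det T_V` and `a` are units). [cite: GelbartRogawski1991, §3.1 p. 454] -/
theorem det_reindex_kronecker_JW_ne_zero (a : Fˣ) : (Matrix.reindex e e (JV ⊗ₖ JW F E a)).det ≠ 0 := by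
  rw [reindex_kronecker_eq_gram_map F E e hJV (JW_eq F E a)]
  exact (UnitaryGroup.isUnit_det_map (algebraMap F E) (isUnit_det_gram F e hVd (isUnit_det_TW F a))).ne_zero

end BigForm

/-! ### [Liu2021, App. D §D.1]'s data at a finite place for `V ⊗ ⟨a⟩`, on the local Weil carrier `ω_v = 𝓢.omegaLoc v` -/

section LocalData

variable (a : Fˣ)
  (𝓢 : LocalSplitting.FinLocalSplittings F E c n hcδ hδ hd (gram F e TV (TW F a)) (isSymm_gram F e hV (isSymm_TW F a))
    (reindex_kronecker_eq_gram_map F E e hJV (JW_eq F E a)))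
  (hn : 3 ≤ n)
  /- Step 2's `μ_v : E_vˣ → ℂ¹`, one per place, with its three printed properties -/
  (μ : ∀ v : HeightOneSpectrum (𝓞 F), (LocalRing E v)ˣ →* ℂˣ) (hμn : ∀ v x, ‖((μ v x : ℂˣ) : ℂ)‖ = 1)
  (hμc : ∀ v, Continuous fun x => ((μ v x : ℂˣ) : ℂ))
  (hμF : ∀ (v : HeightOneSpectrum (𝓞 F)) (t : (v.adicCompletion F)ˣ),
    μ v (Units.map (algebraMap (v.adicCompletion F) (LocalRing E v)).toMonoidHom t) = 1 ↔
      ∃ x : (LocalRing E v)ˣ, (x : LocalRing E v) * conjLocal E c v x = algebraMap (v.adicCompletion F) (LocalRing E v) t)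
  /- Step 3's character of the centre: ONE continuous unitary character `χ₁` of `E¹(𝔸_{F,f})` -/
  (χ₁ : UnitaryGroup.finAdelicOne F E c →* ℂˣ) (hχ₁n : ∀ u, ‖((χ₁ u : ℂˣ) : ℂ)‖ = 1) (hχ₁c : Continuous χ₁)

/-- **[Liu2021, App. D §D.1]'s data `(F_v, E_v, U(V ⊗ ⟨a⟩)(F_v), ε_v, μ_v, χ_{1,v}; ω_v)` AS PRINTED at the finite place
`v`** (`LemD1Data` of `Liu2021/LemD1AsPrinted.lean`), through the junction `LemD1OfPlace.data`: standing data the local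
model of `E/F` at `v` with Gram matrix `J_V ⊗ (a)` (hermitian, `det ≠ 0`, `n ≥ 2`); Step 1's `ε_v = δ ⊗ 1`; Step 2's
`μ_v` the caller's `μ v`; Step 3's character the LOCAL COMPONENT `χ_{1,v}` of `χ₁` (`localCharOfCenter`, unitary and
continuous by §1); and the ⟨CARRIER⟩ `omega` the local Weil representation `ω_v = 𝓢.omegaLoc v` of `U(J_V ⊗ (a))(F_v)` on
`𝒮(F_vⁿ)` (Liu's `ω(ε_v) ∘ ι_{μ_v}` for `V_{ε_v}`, displayed DATA `𝓢`).  Lemma D.1 (1) for THIS datum is the hypothesis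
`LemD1_1AsPrinted (localLemD1Data … v)` of the theorems below — not claimed.
[cite: Liu2021, App. D §D.1 Steps 1∕2∕3 (l. 5217∕5219∕5221), arXiv:2102.11518 chunk p0056 L8–L16 (arXiv PDF p. 76)] -/
def localLemD1Data (v : HeightOneSpectrum (𝓞 F)) :
    LemD1Data (v.adicCompletion F) (LocalRing E v) n (SchwartzBruhat (Fin n → v.adicCompletion F)) :=
  LemD1OfPlace.data E v c n (Matrix.reindex e e (JV ⊗ₖ JW F E a)) hcδ hδ (Nat.le_of_succ_le hn)
    (reindex_kronecker_JW_hermitian F E c N e JV hV hJV a) (det_reindex_kronecker_JW_ne_zero F E N e JV hVd hJV a)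
    (JW F E a) (𝓢.omegaLoc v) (μ v) (hμn v) (hμc v) (hμF v)
    (localCharOfCenter F E c (JW F E a) (JW_apply_ne_zero F E a) χ₁ v)
    (norm_localCharOfCenter F E c (JW F E a) (JW_apply_ne_zero F E a) hχ₁n v)
    (continuous_coe_localCharOfCenter F E c (JW F E a) (JW_apply_ne_zero F E a) hχ₁c v)

/-- unfolding: `localLemD1Data … v` is the junction datum `LemD1OfPlace.data` on `𝓢.omegaLoc v` at `χ_{1,v}`.
[cite: Liu2021, App. D §D.1 Steps 1∕2∕3 (l. 5217∕5219∕5221)] -/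
theorem localLemD1Data_eq (v : HeightOneSpectrum (𝓞 F)) :
    localLemD1Data F E c N e JV hcδ hδ hd hV hVd hJV a 𝓢 hn μ hμn hμc hμF χ₁ hχ₁n hχ₁c v =
      LemD1OfPlace.data E v c n (Matrix.reindex e e (JV ⊗ₖ JW F E a)) hcδ hδ (Nat.le_of_succ_le hn)
        (reindex_kronecker_JW_hermitian F E c N e JV hV hJV a) (det_reindex_kronecker_JW_ne_zero F E N e JV hVd hJV a)
        (JW F E a) (𝓢.omegaLoc v) (μ v) (hμn v) (hμc v) (hμF v)
        (localCharOfCenter F E c (JW F E a) (JW_apply_ne_zero F E a) χ₁ v)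
        (norm_localCharOfCenter F E c (JW F E a) (JW_apply_ne_zero F E a) hχ₁n v)
        (continuous_coe_localCharOfCenter F E c (JW F E a) (JW_apply_ne_zero F E a) hχ₁c v) := rfl

/-- unfolding: the carrier of `localLemD1Data … v` is `ω_v = 𝓢.omegaLoc v` read on `U(V)(F_v)` through `uEquiv`.
[cite: Liu2021, App. D §D.1 Steps 1–2, arXiv:2102.11518 chunk p0056 L12–L14 (arXiv PDF p. 76)] -/
theorem localLemD1Data_omega_apply (v : HeightOneSpectrum (𝓞 F))
    (g : (localLemD1Data F E c N e JV hcδ hδ hd hV hVd hJV a 𝓢 hn μ hμn hμc hμF χ₁ hχ₁n hχ₁c v).S.U) :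
    (localLemD1Data F E c N e JV hcδ hδ hd hV hVd hJV a 𝓢 hn μ hμn hμc hμF χ₁ hχ₁n hχ₁c v).omega g =
      𝓢.omegaLoc v (LemD1OfPlace.uEquiv E v c n (Matrix.reindex e e (JV ⊗ₖ JW F E a)) hcδ hδ (Nat.le_of_succ_le hn)
        (reindex_kronecker_JW_hermitian F E c N e JV hV hJV a) (det_reindex_kronecker_JW_ne_zero F E N e JV hVd hJV a) g) :=
  rfl

/-- unfolding: the `μ` of `localLemD1Data … v` is `μ v`. [cite: Liu2021, App. D §D.1 Step 2, arXiv:2102.11518 chunk p0056 L14 (arXiv PDF p. 76)] -/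
@[simp] theorem localLemD1Data_mu (v : HeightOneSpectrum (𝓞 F)) :
    (localLemD1Data F E c N e JV hcδ hδ hd hV hVd hJV a 𝓢 hn μ hμn hμc hμF χ₁ hχ₁n hχ₁c v).mu = μ v := rfl

/-- unfolding: the character of `localLemD1Data … v` is `χ_{1,v} ∘ θ` (`θ : E_v¹ ↠ U(J_W)(F_v)`, `z ↦ (z)`).
[cite: Liu2021, App. D §D.1 Step 3, arXiv:2102.11518 chunk p0056 L16 (arXiv PDF p. 76)] -/
theorem localLemD1Data_chi_apply (v : HeightOneSpectrum (𝓞 F))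
    (z : (localLemD1Data F E c N e JV hcδ hδ hd hV hVd hJV a 𝓢 hn μ hμn hμc hμF χ₁ hχ₁n hχ₁c v).S.normOne) :
    (localLemD1Data F E c N e JV hcδ hδ hd hV hVd hJV a 𝓢 hn μ hμn hμc hμF χ₁ hχ₁n hχ₁c v).chi z =
      localCharOfCenter F E c (JW F E a) (JW_apply_ne_zero F E a) χ₁ v
        (LemD1OfPlace.theta E v c n (Matrix.reindex e e (JV ⊗ₖ JW F E a)) hcδ hδ (Nat.le_of_succ_le hn)
          (reindex_kronecker_JW_hermitian F E c N e JV hV hJV a) (det_reindex_kronecker_JW_ne_zero F E N e JV hVd hJV a)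
          (JW F E a) z) := rfl

end LocalData

/-! ### `hirr` for `rho … ι ε χ` with the twist exposed, from Lemma D.1 (1) as printed place by place -/

section Rho

variable {s : ∀ a : Fˣ, UnitaryGroup.adelicPair F E c N 1 JV (JW F E a) →* adelicMpCont F (Fin n) (adelicGram F e TV (TW F a))}
  (hs : ∀ a : Fˣ, (splittingDatum F E c N 1 e JV (JW F E a) hcδ hδ hd hV (isSymm_TW F a) hVd (isUnit_det_TW F a) hJV
    (JW_eq F E a)).IsCompatible (s a))
variable (ε : Eps F d) (χ : Chi F E c)
/- THE LOCAL DATA at the line of `ε`: local splittings of `U(J_V ⊗ (lineOf ε))(F_v)` (Liu's `ι_{μ_v}` for `V_{ε_v}`). -/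
variable (𝓢 : LocalSplitting.FinLocalSplittings F E c n hcδ hδ hd (gram F e TV (TW F (lineOf F d ε)))
    (isSymm_gram F e hV (isSymm_TW F (lineOf F d ε)))
    (reindex_kronecker_eq_gram_map F E e hJV (JW_eq F E (lineOf F d ε))))
variable {G : Type*} [Group G] {ι : G →* UnitaryGroup.finAdelic F E c N JV} (hι : Function.Surjective ι)
/- THE TWIST, exposed: `pairSmall₁ s_{lineOf ε} ∘ finPairToAdelic = localRefSection 𝓢 ⊗ χtw` (the shape of F5's `hχ`),
   a factorisation `χ_W = χtw(1, ·) · χ''` of the line character, and the resulting character `χ₁ = χ'' ∘ (u ↦ u·1_W)`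
   of the centre `E¹(𝔸_{F,f})`. -/
variable {χtw : UnitaryGroup.finAdelic F E c N JV × UnitaryGroup.finAdelic F E c 1 (JW F E (lineOf F d ε)) →* ℂˣ}
  (hχtw : (pairSmall₁ F E c N 1 e JV (JW F E (lineOf F d ε)) (s (lineOf F d ε))).comp
      (finPairToAdelic F E c N 1 JV (JW F E (lineOf F d ε))) =
    adelicMpCont.twist F (Fin N × Fin 1) _ (localRefSection F E c N 1 e JV (JW F E (lineOf F d ε)) hcδ hδ hd hV
      (isSymm_TW F _) hJV (JW_eq F E _) 𝓢) χtw)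
  {χ'' : UnitaryGroup.finAdelic F E c 1 (JW F E (lineOf F d ε)) →* ℂˣ}
  (hχ'' : ∀ u, lineChar F E c (lineOf F d ε) χ.1 u = χtw (1, u) * χ'' u)
  {χ₁ : UnitaryGroup.finAdelicOne F E c →* ℂˣ}
  (hχ₁ : χ''.comp (UnitaryGroup.finAdelicCenter F E c 1 (JW F E (lineOf F d ε))) = χ₁)

include hι hχtw hχ'' hχ₁ in
/-- **`hirr` from the place-assembled Weil representation, the twist GIVEN** (F5's `rho_isIrreducible_of_omega_center`
at one character).  Let `s` be a compatible splitting family of the pair data `(V, ⟨a⟩)`, `𝓢` local splittings of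
`U(J_V ⊗ (a))`, `a = lineOf ε`, `ι` onto, `χtw` THE twist of `s_a` against the local reference section of `𝓢`
(`hχtw`), `χ_W = χtw(1, ·) · χ''` (`hχ''`) and `χ₁ = χ'' ∘ (u ↦ u·1_W)` (`hχ₁`).  IF the `U(J_V)(𝔸_{F,f})`-action on the
maximal quotient of `Ω = ⊗'_v ω_v` where the centre `E¹(𝔸_{F,f})` acts by `χ₁` is irreducible, THEN `rho … ι ε χ` is
irreducible (`isIrreducible_weilCoinv_iff_omega_center`).
[cite: Liu2021, Def. 4.11 (l. 2092–2096), App. D §D.1 Step 3 (l. 5221); GelbartRogawski1991, §3.1 Remark p. 457 L4–13] -/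
theorem rho_isIrreducible_of_omega_center_of_twist
    (hirrΩ : (TwistedCoinv.rep χ₁
        (show Representation ℂ (UnitaryGroup.finAdelic F E c N JV) _ from
          𝓢.Omega.comp ((finPairEmb F E c N 1 e JV (JW F E (lineOf F d ε))).comp (MonoidHom.inl _ _)))
        (commute_omega_finPairEmb_finAdelicCenter F E c N e JV (JW F E (lineOf F d ε)) hcδ hδ hd hV (isSymm_TW F _)
          hJV (JW_eq F E _) 𝓢)).IsIrreducible) :
    (rho F E c N e JV hcδ hδ hd hV hVd hJV hs ι ε χ).IsIrreducible := by
  subst hχ₁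
  refine (Representation.isIrreducible_comp_iff_of_surjective _ ι hι).2 ?_
  exact (isIrreducible_weilCoinv_iff_omega_center F E c N e JV (JW F E (lineOf F d ε)) hcδ hδ hd hV (isSymm_TW F _)
    hVd (isUnit_det_TW F _) hJV (JW_eq F E _) 𝓢 (hs (lineOf F d ε)) hχtw hχ'' (JW_apply_ne_zero F E _)).2 hirrΩ

include hι hχtw hχ'' hχ₁ in
/-- **`hirr` from local inputs at ONE character, `TwistedCoinv` currency** (F6's `rho_isIrreducible_of_lemD1_local`
with the twist given).  Under the twist data, IF `χ₁` is continuous, (i) every local central quotient of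
`ω_v = 𝓢.omegaLoc v` at `χ_{1,v}` is an irreducible admissible representation of `U(J_V ⊗ (a))(F_v)` — [Liu2021, App. D
Lemma D.1 (1)] «irreducible and admissible» — and (ii) the class of `1_{𝒪_vⁿ}` at `χ_{1,v}` is non-zero off a finite
set — Def. 4.11's `⊗'` «unramified for all but finitely many `v`» —, THEN `rho … ι ε χ` is irreducible.
[cite: Liu2021, Def. 4.11 (l. 2092–2096), App. D §D.1 Steps 1∕2∕3 (l. 5217∕5219∕5221), Lemma D.1 (l. 5227); Flath1979, Theorem 2 / Example 2] -/
theorem rho_isIrreducible_of_lemD1_local_of_twist (hχ₁c : Continuous χ₁)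
    (hloc : ∀ v,
      (TwistedCoinv.rep (localCharOfCenter F E c (JW F E (lineOf F d ε)) (JW_apply_ne_zero F E _) χ₁ v) (𝓢.omegaLoc v)
          (commute_omegaLoc_localCenter F E c N e JV (JW F E (lineOf F d ε)) hcδ hδ hd hV (isSymm_TW F _) hJV
            (JW_eq F E _) (JW_apply_ne_zero F E _) 𝓢 v)).IsIrreducible ∧
        (TwistedCoinv.rep (localCharOfCenter F E c (JW F E (lineOf F d ε)) (JW_apply_ne_zero F E _) χ₁ v) (𝓢.omegaLoc v)
          (commute_omegaLoc_localCenter F E c N e JV (JW F E (lineOf F d ε)) hcδ hδ hd hV (isSymm_TW F _) hJV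
            (JW_eq F E _) (JW_apply_ne_zero F E _) 𝓢 v)).IsAdmissible)
    (hS : ∃ S₁ : Finset (HeightOneSpectrum (𝓞 F)), ∀ v ∉ S₁,
      TwistedCoinv.mk (show Representation ℂ (UnitaryGroup.localPi E c 1 (JW F E (lineOf F d ε)) v) _ from
          (𝓢.omegaLoc v).comp (localCenter E c n (Matrix.reindex e e (JV ⊗ₖ JW F E (lineOf F d ε))) (JW F E (lineOf F d ε))
            (JW_apply_ne_zero F E _) v))
        (localCharOfCenter F E c (JW F E (lineOf F d ε)) (JW_apply_ne_zero F E _) χ₁ v) (unitVec F (Fin n) v) ≠ 0) :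
    (rho F E c N e JV hcδ hδ hd hV hVd hJV hs ι ε χ).IsIrreducible := by
  obtain ⟨S₁, hS₁⟩ := hS
  exact rho_isIrreducible_of_omega_center_of_twist F E c N e JV hcδ hδ hd hV hVd hJV hs ε χ 𝓢 hι hχtw hχ'' hχ₁
    (omega_center_isIrreducible_of_local F E c N e JV (JW F E (lineOf F d ε)) hcδ hδ hd hV (isSymm_TW F _) hJV
      (JW_eq F E _) (JW_apply_ne_zero F E _) 𝓢 hχ₁c hS₁ (fun v => (hloc v).1) (fun v => (hloc v).2))

include hι hχtw hχ'' hχ₁ in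
/-- **[Liu2021, Def. 4.11]'s «irreducible» for `ω(μ, ε, χ)` — the END displays' `hirr` — from LEMMA D.1 (1) AS PRINTED,
place by place, the twist exposed.**  Let `s` be a compatible splitting family of the pair data `(V, ⟨a⟩)`, `ι` onto,
and, at `a = lineOf ε`, `𝓢` local splittings of `U(J_V ⊗ (a))(F_v)` (Liu's `ι_{μ_v}`; displayed DATA), `χtw` the twist of
`s_a` against the local reference section of `𝓢` with `χ_W = χtw(1, ·) · χ''`, `χ₁ = χ'' ∘ (u ↦ u·1_W)` continuous and
UNITARY, and `μ_v : E_vˣ → ℂ¹` (one per place) with Step 2's three printed properties.  IF, for every finite place `v`,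
[Liu2021, App. D Lemma D.1, first sentence + (1)] holds AS PRINTED for the datum `localLemD1Data … v =
(F_v, E_v, U(V ⊗ ⟨a⟩)(F_v), δ ⊗ 1, μ_v, χ_{1,v}; ω_v = 𝓢.omegaLoc v)` (hypothesis `hD1 v : LemD1_1AsPrinted (…)`), the class
of `1_{𝒪_vⁿ}` in the `χ_{1,v}`-quotient is non-zero off a finite set (Def. 4.11's `⊗'`), and `n ≥ 3`, THEN `rho … ι ε χ`
is irreducible.  (Junction `LemD1OfPlace.isIrreducible_rep_of_lemD1_1AsPrinted` / `isAdmissible_rep_of_lemD1_1AsPrinted`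
at `ω = 𝓢.omegaLoc v`, then `rho_isIrreducible_of_lemD1_local_of_twist`.)
[cite: Liu2021, Def. 4.11 (l. 2092–2096), App. D §D.1 Steps 1∕2∕3 (l. 5217∕5219∕5221), Lemma D.1 (l. 5227; (1) l. 5229), arXiv:2102.11518 chunk p0056 L8–L23 (arXiv PDF p. 76); Flath1979, Theorem 2 / Example 2] -/
theorem rho_isIrreducible_of_lemD1AsPrinted_of_twist (hχ₁c : Continuous χ₁) (hχ₁n : ∀ u, ‖((χ₁ u : ℂˣ) : ℂ)‖ = 1)
    (hn : 3 ≤ n)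
    (μ : ∀ v : HeightOneSpectrum (𝓞 F), (LocalRing E v)ˣ →* ℂˣ) (hμn : ∀ v x, ‖((μ v x : ℂˣ) : ℂ)‖ = 1)
    (hμc : ∀ v, Continuous fun x => ((μ v x : ℂˣ) : ℂ))
    (hμF : ∀ (v : HeightOneSpectrum (𝓞 F)) (t : (v.adicCompletion F)ˣ),
      μ v (Units.map (algebraMap (v.adicCompletion F) (LocalRing E v)).toMonoidHom t) = 1 ↔
        ∃ x : (LocalRing E v)ˣ, (x : LocalRing E v) * conjLocal E c v x =
          algebraMap (v.adicCompletion F) (LocalRing E v) t)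
    (hD1 : ∀ v, LemD1_1AsPrinted
      (localLemD1Data F E c N e JV hcδ hδ hd hV hVd hJV (lineOf F d ε) 𝓢 hn μ hμn hμc hμF χ₁ hχ₁n hχ₁c v))
    (hS : ∃ S₁ : Finset (HeightOneSpectrum (𝓞 F)), ∀ v ∉ S₁,
      TwistedCoinv.mk (show Representation ℂ (UnitaryGroup.localPi E c 1 (JW F E (lineOf F d ε)) v) _ from
          (𝓢.omegaLoc v).comp (localCenter E c n (Matrix.reindex e e (JV ⊗ₖ JW F E (lineOf F d ε))) (JW F E (lineOf F d ε))
            (JW_apply_ne_zero F E _) v))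
        (localCharOfCenter F E c (JW F E (lineOf F d ε)) (JW_apply_ne_zero F E _) χ₁ v) (unitVec F (Fin n) v) ≠ 0) :
    (rho F E c N e JV hcδ hδ hd hV hVd hJV hs ι ε χ).IsIrreducible :=
  rho_isIrreducible_of_lemD1_local_of_twist F E c N e JV hcδ hδ hd hV hVd hJV hs ε χ 𝓢 hι hχtw hχ'' hχ₁ hχ₁c
    (fun v =>
      ⟨LemD1OfPlace.isIrreducible_rep_of_lemD1_1AsPrinted E v c n (Matrix.reindex e e (JV ⊗ₖ JW F E (lineOf F d ε)))
          hcδ hδ (Nat.le_of_succ_le hn) (reindex_kronecker_JW_hermitian F E c N e JV hV hJV _)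
          (det_reindex_kronecker_JW_ne_zero F E N e JV hVd hJV _) (JW F E (lineOf F d ε)) (𝓢.omegaLoc v) (μ v) (hμn v)
          (hμc v) (hμF v) (localCharOfCenter F E c (JW F E (lineOf F d ε)) (JW_apply_ne_zero F E _) χ₁ v)
          (norm_localCharOfCenter F E c (JW F E (lineOf F d ε)) (JW_apply_ne_zero F E _) hχ₁n v)
          (continuous_coe_localCharOfCenter F E c (JW F E (lineOf F d ε)) (JW_apply_ne_zero F E _) hχ₁c v)
          (JW_apply_ne_zero F E _)
          (commute_omegaLoc_localCenter F E c N e JV (JW F E (lineOf F d ε)) hcδ hδ hd hV (isSymm_TW F _) hJV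
            (JW_eq F E _) (JW_apply_ne_zero F E _) 𝓢 v)
          (hD1 v) hn,
        LemD1OfPlace.isAdmissible_rep_of_lemD1_1AsPrinted E v c n (Matrix.reindex e e (JV ⊗ₖ JW F E (lineOf F d ε)))
          hcδ hδ (Nat.le_of_succ_le hn) (reindex_kronecker_JW_hermitian F E c N e JV hV hJV _)
          (det_reindex_kronecker_JW_ne_zero F E N e JV hVd hJV _) (JW F E (lineOf F d ε)) (𝓢.omegaLoc v) (μ v) (hμn v)
          (hμc v) (hμF v) (localCharOfCenter F E c (JW F E (lineOf F d ε)) (JW_apply_ne_zero F E _) χ₁ v)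
          (norm_localCharOfCenter F E c (JW F E (lineOf F d ε)) (JW_apply_ne_zero F E _) hχ₁n v)
          (continuous_coe_localCharOfCenter F E c (JW F E (lineOf F d ε)) (JW_apply_ne_zero F E _) hχ₁c v)
          (JW_apply_ne_zero F E _)
          (commute_omegaLoc_localCenter F E c N e JV (JW F E (lineOf F d ε)) hcδ hδ hd hV (isSymm_TW F _) hJV
            (JW_eq F E _) (JW_apply_ne_zero F E _) 𝓢 v)
          (hD1 v)⟩)
    hS

include hι in
/-- **`hirr` from LEMMA D.1 (1) AS PRINTED when the displayed splitting FACTORS through the local reference section**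
(`χtw = 1`): if `pairSmall₁ s_{lineOf ε} ∘ finPairToAdelic = localRefSection 𝓢` (hypothesis `hfac` — the local-global
compatibility of the displayed `μ`-splitting with the local splittings `𝓢`), the character of the centre is `χ` itself;
so for `χ` UNITARY (`hχn`; automorphic characters of the compact `E¹\E¹(𝔸_{F,f})` are) and `μ_v` as in Step 2:
[Liu2021, Lemma D.1 (1)] AS PRINTED for `localLemD1Data … χ … v` at every finite `v` + Def. 4.11's `⊗'` clause at `χ_v`
+ `n ≥ 3` ⟹ `rho … ι ε χ` irreducible.
[cite: Liu2021, Def. 4.11 (l. 2090–2096), App. D §D.1 Steps 1∕2∕3 (l. 5217∕5219∕5221), Lemma D.1 (l. 5227; (1) l. 5229), arXiv:2102.11518 chunk p0056 L8–L23 (arXiv PDF p. 76); GelbartRogawski1991, §3.1 Prop. 3.1.1 p. 455 L1–3] -/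
theorem rho_isIrreducible_of_lemD1AsPrinted_of_factors
    (hfac : (pairSmall₁ F E c N 1 e JV (JW F E (lineOf F d ε)) (s (lineOf F d ε))).comp
        (finPairToAdelic F E c N 1 JV (JW F E (lineOf F d ε))) =
      localRefSection F E c N 1 e JV (JW F E (lineOf F d ε)) hcδ hδ hd hV (isSymm_TW F _) hJV (JW_eq F E _) 𝓢)
    (hχn : ∀ u, ‖((χ.1 u : ℂˣ) : ℂ)‖ = 1) (hn : 3 ≤ n)
    (μ : ∀ v : HeightOneSpectrum (𝓞 F), (LocalRing E v)ˣ →* ℂˣ) (hμn : ∀ v x, ‖((μ v x : ℂˣ) : ℂ)‖ = 1)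
    (hμc : ∀ v, Continuous fun x => ((μ v x : ℂˣ) : ℂ))
    (hμF : ∀ (v : HeightOneSpectrum (𝓞 F)) (t : (v.adicCompletion F)ˣ),
      μ v (Units.map (algebraMap (v.adicCompletion F) (LocalRing E v)).toMonoidHom t) = 1 ↔
        ∃ x : (LocalRing E v)ˣ, (x : LocalRing E v) * conjLocal E c v x =
          algebraMap (v.adicCompletion F) (LocalRing E v) t)
    (hD1 : ∀ v, LemD1_1AsPrinted
      (localLemD1Data F E c N e JV hcδ hδ hd hV hVd hJV (lineOf F d ε) 𝓢 hn μ hμn hμc hμF χ.1 hχn χ.2.1 v))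
    (hS : ∃ S₁ : Finset (HeightOneSpectrum (𝓞 F)), ∀ v ∉ S₁,
      TwistedCoinv.mk (show Representation ℂ (UnitaryGroup.localPi E c 1 (JW F E (lineOf F d ε)) v) _ from
          (𝓢.omegaLoc v).comp (localCenter E c n (Matrix.reindex e e (JV ⊗ₖ JW F E (lineOf F d ε))) (JW F E (lineOf F d ε))
            (JW_apply_ne_zero F E _) v))
        (localCharOfCenter F E c (JW F E (lineOf F d ε)) (JW_apply_ne_zero F E _) χ.1 v) (unitVec F (Fin n) v) ≠ 0) :
    (rho F E c N e JV hcδ hδ hd hV hVd hJV hs ι ε χ).IsIrreducible :=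
  rho_isIrreducible_of_lemD1AsPrinted_of_twist F E c N e JV hcδ hδ hd hV hVd hJV hs ε χ 𝓢 hι (χtw := 1)
    (hfac.trans (MonoidHom.ext fun h => (adelicMpCont.twist_eq_of_eq_one _ (1 : _ →* ℂˣ) rfl).symm))
    (χ'' := lineChar F E c (lineOf F d ε) χ.1) (fun u => by rw [MonoidHom.one_apply, one_mul])
    (MonoidHom.ext (lineChar_finAdelicCenter F E c (lineOf F d ε) χ.1)) χ.2.1 hχn hn μ hμn hμc hμF hD1 hS

/-! ## §5 `hirr` from Lemma D.1 (1) AS PRINTED at the datum's own character — no unitarity binder -/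

include hι in
/-- **`hirr` from LEMMA D.1 (1) AS PRINTED, the splitting factoring through the local reference section, with NO
unitarity binder.**  This is `rho_isIrreducible_of_lemD1AsPrinted_of_factors` with its hypothesis `hχn : ∀ u, ‖χ u‖ = 1`
DISCHARGED in the kernel: the automorphic characters `χ ∈ Chi F E c` of [Liu2021, Def. 4.11] are unitary —
`Def411WeilCarriers.norm_chi_eq_one` (`Liu2021/Def411WeilCarriersChiUnitary`: `y ↦ χ(y_f)` descends to the COMPACT
`E¹ \ U(1)(𝔸_F)` = `relNormOneIdeles F E ⧸ relNormOneRat F E`), at `[E : F] = 2` (the standing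
`[Algebra.IsQuadraticExtension F E]`) and `c ≠ 1` (`UnitaryGroup.algEquiv_ne_one_of_apply_eq_neg hcδ hδ`).  So, for `ι`
onto: `hfac` (local-global factorisation of the displayed `μ`-splitting through `𝓢`) + Step 2's `μ_v` + **[Liu2021,
Lemma D.1 (1)] AS PRINTED for `localLemD1Data … χ … v` at every finite `v`** + Def. 4.11's `⊗'` clause at `χ_v` + `n ≥ 3`
⟹ `rho … ι ε χ` irreducible.  The remaining inputs are DATA `𝓢` with `hfac`, the per-place as-printed cite `hD1 v`, and
the survival `hS`; nothing of [Liu2021] is asserted.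
[cite: Liu2021, Def. 4.11 (l. 2090–2096), App. D §D.1 Steps 1∕2∕3 (l. 5217∕5219∕5221), Lemma D.1 (l. 5227; (1) l. 5229), arXiv:2102.11518 chunk p0056 L8–L23 (arXiv PDF p. 76); GelbartRogawski1991, §3.1 Prop. 3.1.1 p. 455 L1–3; Godement1964, §5 Thm. 4] -/
theorem rho_isIrreducible_of_lemD1AsPrinted
    (hfac : (pairSmall₁ F E c N 1 e JV (JW F E (lineOf F d ε)) (s (lineOf F d ε))).comp
        (finPairToAdelic F E c N 1 JV (JW F E (lineOf F d ε))) =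
      localRefSection F E c N 1 e JV (JW F E (lineOf F d ε)) hcδ hδ hd hV (isSymm_TW F _) hJV (JW_eq F E _) 𝓢)
    (hn : 3 ≤ n)
    (μ : ∀ v : HeightOneSpectrum (𝓞 F), (LocalRing E v)ˣ →* ℂˣ) (hμn : ∀ v x, ‖((μ v x : ℂˣ) : ℂ)‖ = 1)
    (hμc : ∀ v, Continuous fun x => ((μ v x : ℂˣ) : ℂ))
    (hμF : ∀ (v : HeightOneSpectrum (𝓞 F)) (t : (v.adicCompletion F)ˣ),
      μ v (Units.map (algebraMap (v.adicCompletion F) (LocalRing E v)).toMonoidHom t) = 1 ↔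
        ∃ x : (LocalRing E v)ˣ, (x : LocalRing E v) * conjLocal E c v x =
          algebraMap (v.adicCompletion F) (LocalRing E v) t)
    (hD1 : ∀ v, LemD1_1AsPrinted
      (localLemD1Data F E c N e JV hcδ hδ hd hV hVd hJV (lineOf F d ε) 𝓢 hn μ hμn hμc hμF χ.1
        (norm_chi_eq_one F E c (Algebra.IsQuadraticExtension.finrank_eq_two F E)
          (UnitaryGroup.algEquiv_ne_one_of_apply_eq_neg F E c hcδ hδ) χ) χ.2.1 v))
    (hS : ∃ S₁ : Finset (HeightOneSpectrum (𝓞 F)), ∀ v ∉ S₁,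
      TwistedCoinv.mk (show Representation ℂ (UnitaryGroup.localPi E c 1 (JW F E (lineOf F d ε)) v) _ from
          (𝓢.omegaLoc v).comp (localCenter E c n (Matrix.reindex e e (JV ⊗ₖ JW F E (lineOf F d ε))) (JW F E (lineOf F d ε))
            (JW_apply_ne_zero F E _) v))
        (localCharOfCenter F E c (JW F E (lineOf F d ε)) (JW_apply_ne_zero F E _) χ.1 v) (unitVec F (Fin n) v) ≠ 0) :
    (rho F E c N e JV hcδ hδ hd hV hVd hJV hs ι ε χ).IsIrreducible :=
  rho_isIrreducible_of_lemD1AsPrinted_of_factors F E c N e JV hcδ hδ hd hV hVd hJV hs ε χ 𝓢 hι hfac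
    (norm_chi_eq_one F E c (Algebra.IsQuadraticExtension.finrank_eq_two F E)
      (UnitaryGroup.algEquiv_ne_one_of_apply_eq_neg F E c hcδ hδ) χ) hn μ hμn hμc hμF hD1 hS

end Rho

end Literature.NumberTheory.Automorphic.Liu2021.Def411WeilCarriers

end Liu

end
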